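import Literature.NumberTheory.DiophantineGeometry.ValuationProductElliptic
import Literature.NumberTheory.DiophantineGeometry.MinimalDiscriminantFactorizationProofs
import Literature.NumberTheory.DiophantineGeometry.MinimalDiscriminantProofs
import Mathlib.Analysis.SpecialFunctions.Log.Basic
import HarnessLib

/-!
# Crux `SingleTowerSzpiro` (stmt-ABC-22410): the prime-conductor rung (modulo Mestre–Oesterlé)

A certified INSTANCE of the single-tower bound, with slope `5 < 6` and constant `0`, on the class of elliptic
curves of PRIME conductor — CONDITIONAL on the named fact
`Literature.NumberTheory.DiophantineGeometry.mestreOesterle1989_thm_1` (Mestre–Oesterlé 1989, Théorème 1: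
`N_E = p` prime ⇒ `Δ_min(E) ∣ p⁵`; its printed proof uses modularity, Tate curves, Ribet's level lowering and
Mazur — i.e. exactly the «place-local currency» the line asks for, in the one case where it is in print):

  `N_E` prime ⇒ for every finite place `v`, `ord_v(Δ_min(E)) · log p_v ≤ 5 · log N_E`.

This is the planner's BC5 rung of line `birth` (abc-idea-2, `rung_primeConductor`), re-derived here because the
planner's file is not readable from other jails. It is NOT progress on the crux for general conductor (the
prime-conductor case has `ω(N) = 1`; the crux is about one tower among many); abc is not proved by any of this;
typed ≠ proved; conditional ≠ proved. No `sorry`, no new axiom, no `def`.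
-/

noncomputable section

-- `Summit.<Summit>.<Problem>` is the mandated summit-side namespace (CONVENTIONS §2); for the
-- single-conjunct summit `ABC` the two coincide, so the duplicate `ABC.ABC` is deliberate.
set_option linter.dupNamespace false

namespace Summit.ABC.ABC.Theorems.SingleTowerSzpiroLine

open IsDedekindDomain Literature.NumberTheory.DiophantineGeometry

/-- **Prime conductor ⇒ every tower `≤ 5 log N_E`** (modulo Mestre–Oesterlé, named fact `hMO`): at the
place over `p = N_E` the exponent is `≤ 5` (`Δ_min ∣ p⁵`), at every other place it is `0`.
[cite: MestreOesterle1989, Théorème 1] -/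
theorem tower_le_five_log_of_prime_conductor (hMO : mestreOesterle1989_thm_1) (W : WeierstrassCurve ℚ)
    [W.IsElliptic] (hp : (W.conductorNorm ℤ).Prime) (v : HeightOneSpectrum ℤ) :
    (W.ordMinimalDiscriminant v : ℝ) * Real.log (Rat.HeightOneSpectrum.natGenerator v : ℝ) ≤
      5 * Real.log (W.conductorNorm ℤ : ℝ) := by
  set p := Rat.HeightOneSpectrum.natGenerator v with hpdef
  have hpp : p.Prime := Rat.HeightOneSpectrum.prime_natGenerator v
  have hΔ0 : W.minimalDiscriminantNorm ℤ ≠ 0 := (WeierstrassCurve.minimalDiscriminantNorm_pos_holds W).ne'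
  have hfac : (W.minimalDiscriminantNorm ℤ).factorization p = W.ordMinimalDiscriminant v :=
    WeierstrassCurve.factorization_minimalDiscriminantNorm_holds W v
  have hN1 : (1 : ℝ) ≤ (W.conductorNorm ℤ : ℝ) := by exact_mod_cast hp.one_lt.le
  have hlogN : 0 ≤ Real.log (W.conductorNorm ℤ : ℝ) := Real.log_nonneg hN1
  have hlogp : 0 ≤ Real.log (p : ℝ) := Real.log_nonneg (by exact_mod_cast hpp.one_lt.le)
  by_cases hpN : p = W.conductorNorm ℤ
  · -- the place over `N_E`: `ord_v ≤ 5`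
    have h5 : W.ordMinimalDiscriminant v ≤ 5 := by
      rw [← hfac, hpN]
      exact mestreOesterle1989_thm_1.factorization_le hMO W hp hΔ0
    have h5' : (W.ordMinimalDiscriminant v : ℝ) ≤ 5 := by exact_mod_cast h5
    rw [hpN]
    nlinarith [h5', hlogN]
  · -- any other place: `p_v ∤ Δ_min`, so the tower is `0`
    have hndvd : ¬ p ∣ W.minimalDiscriminantNorm ℤ := by
      intro h
      have h' : p ∣ (W.conductorNorm ℤ) ^ 5 := dvd_trans h (hMO W hp)
      exact hpN ((Nat.prime_dvd_prime_iff_eq hpp hp).mp (hpp.dvd_of_dvd_pow h'))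
    have h0 : W.ordMinimalDiscriminant v = 0 := by
      rw [← hfac]
      exact Nat.factorization_eq_zero_of_not_dvd hndvd
    rw [h0, Nat.cast_zero, zero_mul]
    positivity

/-- **The multiplicative-tower statement (`stub_multiplicativeTower`, slope `6 + ε`) holds on the
prime-conductor class with `ε = 0`, `C = 0`, modulo Mestre–Oesterlé** — the one sub-class where the line's
place-local currency (level lowering mod `ℓ ∣ n_p`) is an inequality-producing theorem in print.
[cite: MestreOesterle1989, Théorème 1] -/
theorem multiplicativeTower_of_prime_conductor (hMO : mestreOesterle1989_thm_1) (ε : ℝ) (hε : 0 ≤ ε)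
    (W : WeierstrassCurve ℚ) [W.IsElliptic] (hp : (W.conductorNorm ℤ).Prime) (v : HeightOneSpectrum ℤ) :
    (W.ordMinimalDiscriminant v : ℝ) * Real.log (Rat.HeightOneSpectrum.natGenerator v : ℝ) ≤
      (6 + ε) * Real.log (W.conductorNorm ℤ : ℝ) + 0 := by
  have h := tower_le_five_log_of_prime_conductor hMO W hp v
  have hN1 : (1 : ℝ) ≤ (W.conductorNorm ℤ : ℝ) := by exact_mod_cast hp.one_lt.le
  have hlogN : 0 ≤ Real.log (W.conductorNorm ℤ : ℝ) := Real.log_nonneg hN1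
  nlinarith [h, hlogN, hε]

end Summit.ABC.ABC.Theorems.SingleTowerSzpiroLine

end
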